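/-
Copyright (c) 2026 the pub-hodgecm-mathlib formalisation cell (harness21).  Prover seat hodgecm-mathlib-F0P3a-p04 (g12), (F8) PROP. 13 (13-iii) «DISPATCH»
(A-p03 (g24) pen-1 partition 2026-09-01 05:28:44Z); LEAD F0P3a-plan (g9) WORD T8-51 (C) ∕ T8-70 (C); architect A-p06 (g26) MAP v3 (F7)∕(F8).
-/
import Literature.NumberTheory.Automorphic.UnitaryThreeBorelConjugateCongruencesJZero
import Literature.NumberTheory.Automorphic.UnitaryThreeBorelCosetCountJZero
import Literature.NumberTheory.Rogawski1990.UnitOrbitalIntegralInertValuesTheta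
import HarnessLib

/-!
# Flicker's PROPOSITION 13 for `m > N`: the `P_H`-coset count of `τ₀ = t₁` (`j = 0`) equals the printed table `iThirteen q N N₊ M m` in the LARGE-`m` half
# — cases (d), (e) and the empty tails; the one norm-residue count of case (e) (precision `2m − N > m`, beyond `ρ_m`) carried as the binder `hce`

Topic `NumberTheory/Rogawski1990` (road «D-N7-inert», MAP v3 (F8), LAYER B); namespace `Literature.NumberTheory.Automorphic.UnitaryGroup` (B-p17's frame, as the
template ★ A-p03 `UnitOrbitalIntegralInertCountJPos` = Prop. 10).  COMPANION of ★ F0P3b-p01 `UnitOrbitalIntegralInertCountJZero` (the half `m ≤ N`: cases (a)(b)(c),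
binder `hmN : m ≤ N`; pen-1 partition A-p03 2026-09-01 05:32:29Z, F0P3b-p01 05:40:21Z «NOT here: `N < m` → p04»): this file is the half `N < m`, same binder
conventions (`hreg` disjunction) so the `j = 0` torus adapter calls either by `le_or_lt`.  THEOREMS ONLY: no definition, no named fact, no instance, no notation, no
`sorry`; kernel lane.  HONEST LABEL: HC_CM is proved only modulo the printed citations until rung 0 closes; this file is a finite count and proves no letter.

THE MATHEMATICS [Flicker1998UnitaryFL, Prop. 13 pp. 91–93].  `τ = !![A,0,B; 0,b,0; B,0,A] ∈ H` (`B₁ = B₂ = B`, `|B| = |ϖ^N|`), `(A − b)∕B = f + g` with `σf = f`,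
`σg = −g` (★ CORE-0 `UnitaryThreeBorelConjugateCongruencesJZero`, p04 (g12)).  The exponents: `N = ord(a−c)`, `N₊ = min(N₁,N₂) ≤ N`, `M = max(N₁,N₂)`; when `N₊ < N`
(`N₁ = N₂ = N₊`) one has `|A − b| = |ϖ^{N₊}| > |B|`; when `N = N₊` one has `N ≤ M`, `|f| ≤ 1`, `|g| = |ϖ^{N₁+N₂−N}| = |ϖ^M|`, `|f² − 1| ≤ |ϖ^{M−N}|` with equality once
`N ≥ 1` (★ `v_sq_sub_one_eq_of_lt`; ★ A-p03 `map_ratio_sub_ratio`) — these are the binders `hs hM hf1 hgM hc₁le hc₁` (the `j = 0` TORUS ADAPTER discharges them at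
Flicker's literal `t₁`).  Then the number of cosets `y ∈ P_H ⧸ (P_H ∩ H^K_m)` with `y⁻¹ τ y ∈ H^K_m` is, by regime:
* («(R-a)» `2m ≤ min(N, N₊)` and `m = 0` live in the companion; here `m > N` so they do not occur — the coset form `natCard_cosets_jzero_eq_index_of_le` is kept for reference);
* «(R-kill)» `N₊ < N`, `N₊ < 2m`: none (`natCard_cosets_jzero_eq_zero_of_v_lt`, ★ `not_condition_four_of_v_lt`);
* «(R-bd)» `N = N₊`, `N < 2m ≤ M`: `q^m · (q^{m−k} q^{m−1}(q+1)) · q^{m−k}`, `k = m − [N∕2]` (★ F0P3b-p01 J2 `natCard_cosets_of_iff_small`, its binder `hbd` DISCHARGED here by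
  ★ `conditions_iff_v_le_of_bounded`: `natCard_cosets_jzero_bd`) `= (q+1)q^{2m+2[N∕2]−1}` = cases (b)∕(d);
* «(R-ce)» `N = N₊`, `M < 2m ≤ M + N`: by ★ `conditions_iff_norm_sub_le_of_near` the condition is the norm congruence `|zσz − c₁| ≤ |ϖ^{2m−N}|`; if `M − N` is ODD there is
  no solution (`natCard_cosets_jzero_eq_zero_of_odd`, ★ `even_of_norm_sub_le_of_near`); if EVEN the count is `(q+1)² q^{2m+N−2}` = case (e) — for `m > N` the precision
  `2m − N` EXCEEDS `m`, so ★ J4 `natCard_cosets_of_iff_norm_sub_le` (`hjm : j ≤ m`, reduction `ρ_m`) does not apply: THIS count is the binder `hce` (values-abstract;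
  a `ρ_{2m−N}`-level count closes it);
* «(R-far)» `2m > M + N`: none (`natCard_cosets_jzero_eq_zero_of_far`, ★ `v_mul_le_sq_of_condition_four`).
Assembled: **`natCard_cosets_jzero_eq_iThirteen_of_lt`** (`N < m`) — `(Nat.card {good cosets} : ℚ) = iThirteen q N N₊ M m` (★ def, (F10) A-p03), ℚ-casts by ★ `natCast_count_b∕c_eq`.
BINDER REMARK (for the adapter): `hs` and `hf1` are CONDITIONAL here (`N₊ < N → |A−b| = |ϖ^{N₊}|`, `N ≤ N₊ → |f| ≤ 1`): when `N₁ = N₂ = N` the sum `(a−b)+(c−b)` may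
cancel (e.g. `c = σa`, `b = 1`: `ord(A−b) = 2·ord(a−b)`), so `|A − b| = |ϖ^{N₊}|` is not always available, and when `N₊ < N` one has `|d| > 1` so `|f| ≤ 1` is not.

## References
* [Flicker1998UnitaryFL] Y. Z. Flicker, *Elementary proof of the fundamental lemma for a unitary group*, Canad. J. Math. 50 (1998): Prop. 13 pp. 91–93, Prop. 8 p. 84.
* [Rogawski1990] J. D. Rogawski, *Automorphic Representations of Unitary Groups in Three Variables* (1990), §4.9 p. 55.
-/

set_option autoImplicit false

open scoped MatrixGroups WithZero Valued
open Matrix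

namespace Literature.NumberTheory.Automorphic

namespace UnitaryGroup

open Literature.NumberTheory.Automorphic.HermitianLattice (unitaryInt mem_unitaryInt_iff LocalConjDatum)
open Literature.NumberTheory.Rogawski1990.Flicker1998 (iThirteen natCast_count_a_eq natCast_count_b_eq natCast_count_c_eq)
open IsLocalRing

variable {K : Type*} [Field K] [Valued K ℤᵐ⁰] {ϖ : K} (σ : K →+* K) {J : Matrix (Fin 3) (Fin 3) K}

/-! ## §1 The Borel coordinates of `p ∈ P_H` are determined by its matrix -/

/-- If `p ∈ P_H` has matrix `!![u,0,u·x; 0,w,0; 0,0,(σu)⁻¹]` then `u` is a unit, `x` is integral anti-fixed and `w` is a norm-one unit (the coordinates of ★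
`exists_coe_eq_borel_of_mem_flickerPH` are read off the entries `(0,0)`, `(0,2)`, `(1,1)`). [cite: Flicker1998UnitaryFL, Prop. 8 p. 84] -/
theorem borel_coords_of_mem_flickerPH (hJ : J = (StdForm.antidiagonal 3).over K) (hd : LocalConjDatum σ ϖ)
    {c p : ↥(unitaryGroupOfForm σ J)} (hc : ((c : GL (Fin 3) K) : Matrix (Fin 3) (Fin 3) K) = !![1, 0, 0; 0, -1, 0; 0, 0, 1])
    (hp : p ∈ flickerPH σ J c) {u x w : K} (hpm : ((p : GL (Fin 3) K) : Matrix (Fin 3) (Fin 3) K) = !![u, 0, u * x; 0, w, 0; 0, 0, (σ u)⁻¹]) :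
    Valued.v u = 1 ∧ Valued.v x ≤ 1 ∧ σ x = -x ∧ Valued.v w = 1 ∧ σ w * w = 1 := by
  obtain ⟨u', x', w', hpm', hvu, hvx, hσx, hvw, hσw⟩ := exists_coe_eq_borel_of_mem_flickerPH σ hJ hd hc hp
  have h00 := congrFun (congrFun (hpm.symm.trans hpm') 0) 0
  have h02 := congrFun (congrFun (hpm.symm.trans hpm') 0) 2
  have h11 := congrFun (congrFun (hpm.symm.trans hpm') 1) 1
  simp only [of_apply, cons_val', cons_val_zero, cons_val_one, cons_val_two, empty_val', cons_val_fin_one] at h00 h02 h11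
  have hu0 : u' ≠ 0 := fun h => by rw [h, map_zero] at hvu; exact zero_ne_one hvu
  subst h00
  have hx : x = x' := mul_left_cancel₀ hu0 h02
  subst hx
  subst h11
  exact ⟨hvu, hvx, hσx, hvw, hσw⟩

/-! ## §2 The coset counts of the `j = 0` regimes -/

/-- **(R-kill) as a coset count**: if `|B| < |A − b|` and `|t|² < |A − b|` (`N₊ < N`, `N₊ < 2m`), NO coset conjugates `τ` into `H^K_m`.
[cite: Flicker1998UnitaryFL, Prop. 13 p. 93] -/
theorem natCard_cosets_jzero_eq_zero_of_v_lt (hJ : J = (StdForm.antidiagonal 3).over K) (hd : LocalConjDatum σ ϖ) {y : K} (hy : y * σ y = -2) (m : ℕ)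
    {c um τ : ↥(unitaryGroupOfForm σ J)} (hc : ((c : GL (Fin 3) K) : Matrix (Fin 3) (Fin 3) K) = !![1, 0, 0; 0, -1, 0; 0, 0, 1])
    (hum : ((um : GL (Fin 3) K) : Matrix (Fin 3) (Fin 3) K) = !![ϖ ^ m, y, (ϖ ^ m)⁻¹; 0, 1, -σ y * (ϖ ^ m)⁻¹; 0, 0, (ϖ ^ m)⁻¹])
    {A B b : K} (hτ : ((τ : GL (Fin 3) K) : Matrix (Fin 3) (Fin 3) K) = !![A, 0, B; 0, b, 0; B, 0, A])
    (hτH : τ ∈ Subgroup.centralizer ({c} : Set ↥(unitaryGroupOfForm σ J)))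
    (hBs : Valued.v B < Valued.v (A - b)) (hts : Valued.v (ϖ ^ m) * Valued.v (ϖ ^ m) < Valued.v (A - b)) :
    Nat.card {w : ↥(flickerPH σ J c) ⧸ (flickerHK σ J c um).subgroupOf (flickerPH σ J c) //
      ((Quotient.out w : ↥(flickerPH σ J c)) : ↥(unitaryGroupOfForm σ J))⁻¹ * τ * (Quotient.out w : ↥(flickerPH σ J c)) ∈ flickerHK σ J c um} = 0 := by
  have h2 : (2 : K) ≠ 0 := fun h => by have := hd.v2; rw [h, map_zero] at this; exact zero_ne_one this
  refine natCard_cosets_eq_zero_of_forall_not σ fun p hp hmem => ?_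
  obtain ⟨u, x, w, hpm, hvu, hvx, hσx, hvw, hσw⟩ := exists_coe_eq_borel_of_mem_flickerPH σ hJ hd hc hp
  have hu0 : u ≠ 0 := fun h => by rw [h, map_zero] at hvu; exact zero_ne_one hvu
  have hσu0 : σ u ≠ 0 := fun h => hu0 (by rw [← hd.σσ u, h, map_zero])
  have hw0 : w ≠ 0 := fun h => by rw [h, map_zero] at hvw; exact zero_ne_one hvw
  have hpH : p ∈ Subgroup.centralizer ({c} : Set ↥(unitaryGroupOfForm σ J)) := ((mem_flickerPH_iff h2 hc).1 hp).1.1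
  obtain ⟨-, -, -, h₄⟩ := (borel_conj_mem_flickerHK_iff σ hJ hd hy m hu0 hσu0 hw0 hum hpm hτ hpH hτH).1 hmem
  have hn : Valued.v (u * σ u) = 1 := by rw [map_mul, hd.vσ, hvu, mul_one]
  exact not_condition_four_of_v_lt σ hd hn hvx hBs hts h₄

/-- **(R-far) as a coset count**: if `|t|² < |B|·|g|` (`2m > N₁ + N₂`), NO coset conjugates `τ` into `H^K_m` (★ `v_mul_le_sq_of_condition_four`).
[cite: Flicker1998UnitaryFL, Prop. 13 p. 92] -/
theorem natCard_cosets_jzero_eq_zero_of_far (hJ : J = (StdForm.antidiagonal 3).over K) (hd : LocalConjDatum σ ϖ) {y : K} (hy : y * σ y = -2) (m : ℕ)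
    {c um τ : ↥(unitaryGroupOfForm σ J)} (hc : ((c : GL (Fin 3) K) : Matrix (Fin 3) (Fin 3) K) = !![1, 0, 0; 0, -1, 0; 0, 0, 1])
    (hum : ((um : GL (Fin 3) K) : Matrix (Fin 3) (Fin 3) K) = !![ϖ ^ m, y, (ϖ ^ m)⁻¹; 0, 1, -σ y * (ϖ ^ m)⁻¹; 0, 0, (ϖ ^ m)⁻¹])
    {A B b f g : K} (hτ : ((τ : GL (Fin 3) K) : Matrix (Fin 3) (Fin 3) K) = !![A, 0, B; 0, b, 0; B, 0, A])
    (hτH : τ ∈ Subgroup.centralizer ({c} : Set ↥(unitaryGroupOfForm σ J))) (hB0 : B ≠ 0)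
    (hfg : (A - b) / B = f + g) (hσf : σ f = f) (hσg : σ g = -g) (hfar : Valued.v (ϖ ^ m) * Valued.v (ϖ ^ m) < Valued.v B * Valued.v g) :
    Nat.card {w : ↥(flickerPH σ J c) ⧸ (flickerHK σ J c um).subgroupOf (flickerPH σ J c) //
      ((Quotient.out w : ↥(flickerPH σ J c)) : ↥(unitaryGroupOfForm σ J))⁻¹ * τ * (Quotient.out w : ↥(flickerPH σ J c)) ∈ flickerHK σ J c um} = 0 := by
  have h2 : (2 : K) ≠ 0 := fun h => by have := hd.v2; rw [h, map_zero] at this; exact zero_ne_one this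
  refine natCard_cosets_eq_zero_of_forall_not σ fun p hp hmem => ?_
  obtain ⟨u, x, w, hpm, hvu, hvx, hσx, hvw, hσw⟩ := exists_coe_eq_borel_of_mem_flickerPH σ hJ hd hc hp
  have hu0 : u ≠ 0 := fun h => by rw [h, map_zero] at hvu; exact zero_ne_one hvu
  have hσu0 : σ u ≠ 0 := fun h => hu0 (by rw [← hd.σσ u, h, map_zero])
  have hw0 : w ≠ 0 := fun h => by rw [h, map_zero] at hvw; exact zero_ne_one hvw
  have hpH : p ∈ Subgroup.centralizer ({c} : Set ↥(unitaryGroupOfForm σ J)) := ((mem_flickerPH_iff h2 hc).1 hp).1.1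
  obtain ⟨-, -, -, h₄⟩ := (borel_conj_mem_flickerHK_iff σ hJ hd hy m hu0 hσu0 hw0 hum hpm hτ hpH hτH).1 hmem
  have hn : Valued.v (u * σ u) = 1 := by rw [map_mul, hd.vσ, hvu, mul_one]
  have hσn : σ (u * σ u) = u * σ u := by rw [map_mul, hd.σσ, mul_comm]
  exact absurd (v_mul_le_sq_of_condition_four σ hd hB0 hn hσn hfg hσf hσg hσx h₄) (not_le.2 hfar)

/-- **(R-ce) with ODD `ord c₁`: no coset** (cases (c)∕(e) when `M − N` is odd): in the regime of ★ `conditions_iff_norm_sub_le_of_near`, a solution would make `|f² − 1|` an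
EVEN power of `exp(−1)` (★ `even_of_norm_sub_le_of_near`). [cite: Flicker1998UnitaryFL, Prop. 13 (c)(e) pp. 92–93] -/
theorem natCard_cosets_jzero_eq_zero_of_odd (hJ : J = (StdForm.antidiagonal 3).over K) (hd : LocalConjDatum σ ϖ) {y : K} (hy : y * σ y = -2) {m N : ℕ}
    (hN : N ≤ 2 * m)
    {c um τ : ↥(unitaryGroupOfForm σ J)} (hc : ((c : GL (Fin 3) K) : Matrix (Fin 3) (Fin 3) K) = !![1, 0, 0; 0, -1, 0; 0, 0, 1])
    (hum : ((um : GL (Fin 3) K) : Matrix (Fin 3) (Fin 3) K) = !![ϖ ^ m, y, (ϖ ^ m)⁻¹; 0, 1, -σ y * (ϖ ^ m)⁻¹; 0, 0, (ϖ ^ m)⁻¹])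
    {A B b f g : K} (hτ : ((τ : GL (Fin 3) K) : Matrix (Fin 3) (Fin 3) K) = !![A, 0, B; 0, b, 0; B, 0, A])
    (hτH : τ ∈ Subgroup.centralizer ({c} : Set ↥(unitaryGroupOfForm σ J)))
    (hB : Valued.v B = Valued.v (ϖ ^ N)) (hfg : (A - b) / B = f + g) (hσf : σ f = f) (hf1 : Valued.v f ≤ 1)
    (hg : Valued.v g ≤ Valued.v (ϖ ^ (2 * m - N))) (hnear : Valued.v (ϖ ^ (2 * m - N)) < Valued.v (f ^ 2 - 1))
    (hfar : Valued.v (f ^ 2 - 1) ≤ Valued.v (ϖ ^ (2 * (m - N)))) (hodd : ¬ ∃ e : ℤ, Valued.v (f ^ 2 - 1) = WithZero.exp (2 * e)) :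
    Nat.card {w : ↥(flickerPH σ J c) ⧸ (flickerHK σ J c um).subgroupOf (flickerPH σ J c) //
      ((Quotient.out w : ↥(flickerPH σ J c)) : ↥(unitaryGroupOfForm σ J))⁻¹ * τ * (Quotient.out w : ↥(flickerPH σ J c)) ∈ flickerHK σ J c um} = 0 := by
  have h2 : (2 : K) ≠ 0 := fun h => by have := hd.v2; rw [h, map_zero] at this; exact zero_ne_one this
  refine natCard_cosets_eq_zero_of_forall_not σ fun p hp hmem => ?_
  obtain ⟨u, x, w, hpm, hvu, hvx, hσx, hvw, hσw⟩ := exists_coe_eq_borel_of_mem_flickerPH σ hJ hd hc hp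
  have hu0 : u ≠ 0 := fun h => by rw [h, map_zero] at hvu; exact zero_ne_one hvu
  have hσu0 : σ u ≠ 0 := fun h => hu0 (by rw [← hd.σσ u, h, map_zero])
  have hw0 : w ≠ 0 := fun h => by rw [h, map_zero] at hvw; exact zero_ne_one hvw
  have hpH : p ∈ Subgroup.centralizer ({c} : Set ↥(unitaryGroupOfForm σ J)) := ((mem_flickerPH_iff h2 hc).1 hp).1.1
  obtain ⟨-, h₂, h₃, h₄⟩ := (borel_conj_mem_flickerHK_iff σ hJ hd hy m hu0 hσu0 hw0 hum hpm hτ hpH hτH).1 hmem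
  have hn : Valued.v (u * σ u) = 1 := by rw [map_mul, hd.vσ, hvu, mul_one]
  have hσn : σ (u * σ u) = u * σ u := by rw [map_mul, hd.σσ, mul_comm]
  have hsol := (conditions_iff_norm_sub_le_of_near σ hd (A := A) (b := b) hB hN hn hσn hσx hfg hσf hf1 hg hnear hfar).1 ⟨h₂, h₃, h₄⟩
  exact hodd (even_of_norm_sub_le_of_near σ hd hnear hsol)

/-- **(R-a) at `j = 0` as a coset count**: `|A − b| ≤ |t|²`, `|B| ≤ |t|²` ⇒ the count is the index (★ `natCard_cosets_eq_index_of_le` with `B₂ϖ^{2·0} = B`).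
[cite: Flicker1998UnitaryFL, Prop. 13 (a) p. 91] -/
theorem natCard_cosets_jzero_eq_index_of_le (hJ : J = (StdForm.antidiagonal 3).over K) (hd : LocalConjDatum σ ϖ) {y : K} (hy : y * σ y = -2) (m : ℕ)
    {c um τ : ↥(unitaryGroupOfForm σ J)} (hc : ((c : GL (Fin 3) K) : Matrix (Fin 3) (Fin 3) K) = !![1, 0, 0; 0, -1, 0; 0, 0, 1])
    (hum : ((um : GL (Fin 3) K) : Matrix (Fin 3) (Fin 3) K) = !![ϖ ^ m, y, (ϖ ^ m)⁻¹; 0, 1, -σ y * (ϖ ^ m)⁻¹; 0, 0, (ϖ ^ m)⁻¹])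
    {A B b : K} (hτ : ((τ : GL (Fin 3) K) : Matrix (Fin 3) (Fin 3) K) = !![A, 0, B; 0, b, 0; B, 0, A])
    (hτH : τ ∈ Subgroup.centralizer ({c} : Set ↥(unitaryGroupOfForm σ J)))
    (hs : Valued.v (A - b) ≤ Valued.v (ϖ ^ m) * Valued.v (ϖ ^ m)) (hBt : Valued.v B ≤ Valued.v (ϖ ^ m) * Valued.v (ϖ ^ m)) :
    Nat.card {w : ↥(flickerPH σ J c) ⧸ (flickerHK σ J c um).subgroupOf (flickerPH σ J c) //
      ((Quotient.out w : ↥(flickerPH σ J c)) : ↥(unitaryGroupOfForm σ J))⁻¹ * τ * (Quotient.out w : ↥(flickerPH σ J c)) ∈ flickerHK σ J c um} =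
      ((flickerHK σ J c um).subgroupOf (flickerPH σ J c)).index := by
  have hτ0 : ((τ : GL (Fin 3) K) : Matrix (Fin 3) (Fin 3) K) = !![A, 0, B * ϖ ^ (2 * 0); 0, b, 0; B, 0, A] := by rw [hτ, mul_zero, pow_zero, mul_one]
  exact natCard_cosets_eq_index_of_le σ hJ hd hy m hc hum (j := 0) hτ0 hτH hs hBt

section Count

variable [IsDiscreteValuationRing 𝒪[K]] [Finite (ResidueField 𝒪[K])] [IsAdicComplete (maximalIdeal 𝒪[K]) 𝒪[K]]

/-- **(R-bd) as a coset count** (cases (b)∕(d)): in the bounded regime of ★ `conditions_iff_v_le_of_bounded` (`N < 2m`, `|f| ≤ 1`, `|f² − 1|, |g| ≤ |ϖ^{2m−N}|`,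
`k := m − [N∕2] ≤ m`) the binder `hbd` of ★ F0P3b-p01 `natCard_cosets_of_iff_small` is DISCHARGED, so the count is `F · (q^{m−k}·q^{m−1}(q+1)) · q^{m−k}`.
[cite: Flicker1998UnitaryFL, Prop. 13 (b)(d) pp. 91–93] -/
theorem natCard_cosets_jzero_bd (hJ : J = (StdForm.antidiagonal 3).over K) (hd : LocalConjDatum σ ϖ)
    (hσO : ∀ y : 𝒪[K], (σ.comp 𝒪[K].subtype) y ∈ 𝒪[K]) {y : K} (hy : y * σ y = -2) {m N : ℕ} (hm : 1 ≤ m) (hN : N < 2 * m)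
    {c um τ : ↥(unitaryGroupOfForm σ J)} (hc : ((c : GL (Fin 3) K) : Matrix (Fin 3) (Fin 3) K) = !![1, 0, 0; 0, -1, 0; 0, 0, 1])
    (hum : ((um : GL (Fin 3) K) : Matrix (Fin 3) (Fin 3) K) = !![ϖ ^ m, y, (ϖ ^ m)⁻¹; 0, 1, -σ y * (ϖ ^ m)⁻¹; 0, 0, (ϖ ^ m)⁻¹])
    {A B b f g : K} (hτ : ((τ : GL (Fin 3) K) : Matrix (Fin 3) (Fin 3) K) = !![A, 0, B; 0, b, 0; B, 0, A])
    (hτH : τ ∈ Subgroup.centralizer ({c} : Set ↥(unitaryGroupOfForm σ J)))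
    (hB : Valued.v B = Valued.v (ϖ ^ N)) (hfg : (A - b) / B = f + g) (hσf : σ f = f) (hf1 : Valued.v f ≤ 1)
    (hc₁ : Valued.v (f ^ 2 - 1) ≤ Valued.v (ϖ ^ (2 * m - N))) (hg : Valued.v g ≤ Valued.v (ϖ ^ (2 * m - N)))
    {q : ℕ} (hq : Nat.card (ResidueField 𝒪[K]) = q ^ 2)
    {a₀ : 𝒪[K]} (ha₀ : IsUnit (((σ.comp 𝒪[K].subtype).codRestrict 𝒪[K] hσO) a₀ - a₀))
    (hSN : flickerPH σ J c ⊓ flickerHK σ J c um ≤ flickerPH0 σ J c (ϖ ^ m))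
    [Finite (↥(flickerPH σ J c) ⧸ (flickerHK σ J c um).subgroupOf (flickerPH σ J c))] {F : ℕ}
    (hfib : ∀ z ∈ Set.range (fun w : ↥(flickerPH σ J c) ⧸ (flickerHK σ J c um).subgroupOf (flickerPH σ J c) =>
        flickerPHRho σ m ((Quotient.out w : ↥(flickerPH σ J c)) : ↥(unitaryGroupOfForm σ J))),
      Nat.card {w : ↥(flickerPH σ J c) ⧸ (flickerHK σ J c um).subgroupOf (flickerPH σ J c) //
        flickerPHRho σ m ((Quotient.out w : ↥(flickerPH σ J c)) : ↥(unitaryGroupOfForm σ J)) = z} = F) :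
    Nat.card {w : ↥(flickerPH σ J c) ⧸ (flickerHK σ J c um).subgroupOf (flickerPH σ J c) //
      ((Quotient.out w : ↥(flickerPH σ J c)) : ↥(unitaryGroupOfForm σ J))⁻¹ * τ * (Quotient.out w : ↥(flickerPH σ J c)) ∈ flickerHK σ J c um} =
      F * ((q ^ (m - (m - N / 2)) * (q ^ (m - 1) * (q + 1))) * q ^ (m - (m - N / 2))) := by
  have h2 : (2 : K) ≠ 0 := fun h => by have := hd.v2; rw [h, map_zero] at this; exact zero_ne_one this
  have hB0 : B ≠ 0 := fun h => by rw [h, map_zero] at hB; exact (pow_ne_zero N hd.ϖ_ne_zero) ((Valuation.zero_iff _).1 hB.symm)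
  -- `|f| = 1` (since `|f² − 1| < 1`) and `σ f = f`: the `e` of J2
  have hρ1 : Valued.v (ϖ ^ (2 * m - N)) < 1 := by rw [hd.v_pow, ← WithZero.exp_zero, WithZero.exp_lt_exp]; omega
  have hfv : Valued.v f = 1 := by
    by_contra hne
    have hlt : Valued.v (f ^ 2) < Valued.v (1 : K) := by
      rw [map_pow, map_one]; exact pow_lt_one₀ zero_le (lt_of_le_of_ne hf1 hne) two_ne_zero
    have : Valued.v (f ^ 2 - 1) = 1 := by rw [Valuation.map_sub_eq_of_lt_right _ hlt, map_one]
    exact absurd (lt_of_le_of_lt hc₁ hρ1) (by rw [this]; exact lt_irrefl _)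
  refine natCard_cosets_of_iff_small σ hJ hd hσO hm (k := m - N / 2) (by omega) (by omega) hc hfv hσf ?_ hq ha₀ hSN hfib
  -- the binder `hbd`
  intro p hp u x w hpm
  obtain ⟨hvu, hvx, hσx, hvw, -⟩ := borel_coords_of_mem_flickerPH σ hJ hd hc hp hpm
  have hu0 : u ≠ 0 := fun h => by rw [h, map_zero] at hvu; exact zero_ne_one hvu
  have hσu0 : σ u ≠ 0 := fun h => hu0 (by rw [← hd.σσ u, h, map_zero])
  have hw0 : w ≠ 0 := fun h => by rw [h, map_zero] at hvw; exact zero_ne_one hvw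
  have hpH : p ∈ Subgroup.centralizer ({c} : Set ↥(unitaryGroupOfForm σ J)) := ((mem_flickerPH_iff h2 hc).1 hp).1.1
  have hn : Valued.v (u * σ u) = 1 := by rw [map_mul, hd.vσ, hvu, mul_one]
  have hσn : σ (u * σ u) = u * σ u := by rw [map_mul, hd.σσ, mul_comm]
  rw [borel_conj_mem_flickerHK_iff σ hJ hd hy m hu0 hσu0 hw0 hum hpm hτ hpH hτH,
    and_iff_right (show Valued.v ((u * σ u) * B) ≤ 1 by rw [map_mul, hn, one_mul, hB]; exact hd.v_pow_le_one N)]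
  exact conditions_iff_v_le_of_bounded σ hd (A := A) (b := b) hB (by omega) hn hσn hσx hfg hσf hf1 hc₁ hg

/-! ## §3 PROPOSITION 13 (the dispatch; the (c)∕(e) count enters as the binder `hce`) -/

/-- The `ℚ`-cast of the (b)∕(d) count: `q^m · (q^{[N∕2]} · q^{m−1}(q+1)) · q^{[N∕2]} = (1 + q⁻¹) q^{2m + 2[N∕2]}` (`m ≥ 1`). [cite: Flicker1998UnitaryFL, Prop. 13 p. 92] -/
theorem cast_count_bd_eq {q m N : ℕ} (hq : 1 ≤ q) (hm : 1 ≤ m) (hNm : N / 2 ≤ m) :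
    ((q ^ m * ((q ^ (m - (m - N / 2)) * (q ^ (m - 1) * (q + 1))) * q ^ (m - (m - N / 2))) : ℕ) : ℚ) =
      (1 + ((q : ℚ))⁻¹) * (q : ℚ) ^ (2 * m + 2 * (N / 2)) := by
  rw [show m - (m - N / 2) = N / 2 by omega, ← natCast_count_b_eq hq (k := 2 * m + 2 * (N / 2)) (by omega)]
  congr 1
  rw [show 2 * m + 2 * (N / 2) - 1 = m + (N / 2 + (m - 1) + N / 2) by omega]
  ring

/-- **FLICKER'S PROPOSITION 13, the half `N < m`** (`j = 0`): for `τ = !![A,0,B; 0,b,0; B,0,A] ∈ H` with `|B| = |ϖ^N|`, `(A−b)∕B = f + g` (`σf = f`, `σg = −g`) and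
the exponent data of the companion's `hreg` (`N₊ < N`, or `N ≤ N₊ ∧ N ≤ M ∧ |f² − 1| = |ϖ^{M−N}| ∧ |g| = |ϖ^M|`) [+ `N₊ < N → |A − b| = |ϖ^{N₊}|`, `N ≤ N₊ → |f| ≤ 1`],
the number of cosets `y ∈ P_H ⧸ (P_H ∩ H^K_m)` with `y⁻¹ τ y ∈ H^K_m` is the printed table ★ `iThirteen q N N₊ M m` — given Prop. 8's index (`hidx`), the fibre size `q^m`
of `ρ_m` (`hfib`), and the binder `hce` = the case-(e) norm-residue count `(q+1)² q^{2m+N−2}` under its pointwise criterion (precision `2m − N > m`).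
[cite: Flicker1998UnitaryFL, Prop. 13 (d)(e) pp. 91–92] -/
theorem natCard_cosets_jzero_eq_iThirteen_of_lt (hJ : J = (StdForm.antidiagonal 3).over K) (hd : LocalConjDatum σ ϖ)
    (hσO : ∀ y : 𝒪[K], (σ.comp 𝒪[K].subtype) y ∈ 𝒪[K]) {y : K} (hy : y * σ y = -2)
    {m N Np M : ℕ} (hNm : N < m)
    {c um τ : ↥(unitaryGroupOfForm σ J)} (hc : ((c : GL (Fin 3) K) : Matrix (Fin 3) (Fin 3) K) = !![1, 0, 0; 0, -1, 0; 0, 0, 1])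
    (hum : ((um : GL (Fin 3) K) : Matrix (Fin 3) (Fin 3) K) = !![ϖ ^ m, y, (ϖ ^ m)⁻¹; 0, 1, -σ y * (ϖ ^ m)⁻¹; 0, 0, (ϖ ^ m)⁻¹])
    {A B b f g : K} (hτ : ((τ : GL (Fin 3) K) : Matrix (Fin 3) (Fin 3) K) = !![A, 0, B; 0, b, 0; B, 0, A])
    (hτH : τ ∈ Subgroup.centralizer ({c} : Set ↥(unitaryGroupOfForm σ J)))
    (hB : Valued.v B = Valued.v (ϖ ^ N)) (hs : Np < N → Valued.v (A - b) = Valued.v (ϖ ^ Np))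
    (hfg : (A - b) / B = f + g) (hσf : σ f = f) (hσg : σ g = -g) (hf1 : N ≤ Np → Valued.v f ≤ 1)
    (hreg : Np < N ∨ (N ≤ Np ∧ N ≤ M ∧ Valued.v (f ^ 2 - 1) = Valued.v (ϖ ^ (M - N)) ∧ Valued.v g = Valued.v (ϖ ^ M)))
    {q : ℕ} (hq : Nat.card (ResidueField 𝒪[K]) = q ^ 2)
    {a₀ : 𝒪[K]} (ha₀ : IsUnit (((σ.comp 𝒪[K].subtype).codRestrict 𝒪[K] hσO) a₀ - a₀))
    (hSN : flickerPH σ J c ⊓ flickerHK σ J c um ≤ flickerPH0 σ J c (ϖ ^ m))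
    [Finite (↥(flickerPH σ J c) ⧸ (flickerHK σ J c um).subgroupOf (flickerPH σ J c))]
    (hfib : ∀ z ∈ Set.range (fun w : ↥(flickerPH σ J c) ⧸ (flickerHK σ J c um).subgroupOf (flickerPH σ J c) =>
        flickerPHRho σ m ((Quotient.out w : ↥(flickerPH σ J c)) : ↥(unitaryGroupOfForm σ J))),
      Nat.card {w : ↥(flickerPH σ J c) ⧸ (flickerHK σ J c um).subgroupOf (flickerPH σ J c) //
        flickerPHRho σ m ((Quotient.out w : ↥(flickerPH σ J c)) : ↥(unitaryGroupOfForm σ J)) = z} = q ^ m)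
    (hce : N ≤ Np → M < 2 * m → 2 * m ≤ M + N → (M - N) % 2 = 0 →
      (∀ p ∈ flickerPH σ J c, ∀ u x w : K,
        ((p : GL (Fin 3) K) : Matrix (Fin 3) (Fin 3) K) = !![u, 0, u * x; 0, w, 0; 0, 0, (σ u)⁻¹] →
          (p⁻¹ * τ * p ∈ flickerHK σ J c um ↔
            Valued.v (((u * σ u)⁻¹ + f + x) * σ ((u * σ u)⁻¹ + f + x) - (f ^ 2 - 1)) ≤ Valued.v (ϖ ^ (2 * m - N)))) →
      Nat.card {w : ↥(flickerPH σ J c) ⧸ (flickerHK σ J c um).subgroupOf (flickerPH σ J c) //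
        ((Quotient.out w : ↥(flickerPH σ J c)) : ↥(unitaryGroupOfForm σ J))⁻¹ * τ * (Quotient.out w : ↥(flickerPH σ J c)) ∈ flickerHK σ J c um} =
        (q + 1) ^ 2 * q ^ (2 * m + N - 2)) :
    (Nat.card {w : ↥(flickerPH σ J c) ⧸ (flickerHK σ J c um).subgroupOf (flickerPH σ J c) //
      ((Quotient.out w : ↥(flickerPH σ J c)) : ↥(unitaryGroupOfForm σ J))⁻¹ * τ * (Quotient.out w : ↥(flickerPH σ J c)) ∈ flickerHK σ J c um} : ℚ) =
      iThirteen q N Np M m := by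
  have hq0 : q ≠ 0 := by
    rintro rfl
    have h1 : 0 < Nat.card (ResidueField 𝒪[K]) := Nat.card_pos
    rw [hq] at h1; simp at h1
  have hq1 : 1 ≤ q := Nat.pos_of_ne_zero hq0
  have h2 : (2 : K) ≠ 0 := fun h => by have := hd.v2; rw [h, map_zero] at this; exact zero_ne_one this
  have hB0 : B ≠ 0 := fun h => by rw [h, map_zero] at hB; exact (pow_ne_zero N hd.ϖ_ne_zero) ((Valuation.zero_iff _).1 hB.symm)
  have hvmm : Valued.v (ϖ ^ m) * Valued.v (ϖ ^ m) = Valued.v (ϖ ^ (2 * m)) := by rw [← map_mul, ← pow_add, two_mul]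
  have vle : ∀ {a b : ℕ}, Valued.v (ϖ ^ a) ≤ Valued.v (ϖ ^ b) ↔ b ≤ a := fun {a b} => by rw [hd.v_pow, hd.v_pow, WithZero.exp_le_exp]; omega
  have vlt : ∀ {a b : ℕ}, Valued.v (ϖ ^ a) < Valued.v (ϖ ^ b) ↔ b < a := fun {a b} => by rw [hd.v_pow, hd.v_pow, WithZero.exp_lt_exp]; omega
  have hm : 1 ≤ m := by omega
  have hm0 : m ≠ 0 := by omega
  rcases hreg with hlt | ⟨hge, hNM, hc₁v, hgv⟩
  · -- N₊ < N < m : (R-kill)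
    rw [natCard_cosets_jzero_eq_zero_of_v_lt σ hJ hd hy m hc hum hτ hτH (by rw [hB, hs hlt, vlt]; exact hlt)
        (by rw [hvmm, hs hlt, vlt]; omega),
      iThirteen, if_neg hm0, if_neg (by omega), if_neg (by omega), if_neg (by omega), if_neg (by omega), if_neg (by omega), Nat.cast_zero]
  · -- N = N₊ < m
    by_cases hfar2 : M + N < 2 * m
    · -- (R-far)
      rw [natCard_cosets_jzero_eq_zero_of_far σ hJ hd hy m hc hum hτ hτH hB0 hfg hσf hσg
          (by rw [hvmm, hB, hgv, ← map_mul, ← pow_add, vlt]; omega),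
        iThirteen, if_neg hm0, if_neg (by omega), if_neg (by omega), if_neg (by omega), if_neg (by omega), if_neg (by omega), Nat.cast_zero]
    have hg2 : Valued.v g ≤ Valued.v (ϖ ^ (2 * m - N)) := by rw [hgv, vle]; omega
    by_cases hbd : 2 * m ≤ M
    · -- (R-bd) : case (d)
      have hcnt := natCard_cosets_jzero_bd σ hJ hd hσO hy hm (by omega) hc hum hτ hτH hB hfg hσf (hf1 hge)
        (by rw [hc₁v, vle]; omega) hg2 hq ha₀ hSN hfib
      rw [hcnt, cast_count_bd_eq hq1 hm (by omega), iThirteen, if_neg hm0, if_neg (by omega), if_neg (by omega), if_neg (by omega),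
        if_pos ⟨hge, by omega, by omega⟩]
    · -- (R-ce) : case (e), `M < 2m ≤ M + N`
      have hnear : Valued.v (ϖ ^ (2 * m - N)) < Valued.v (f ^ 2 - 1) := by rw [hc₁v, vlt]; omega
      have hfar' : Valued.v (f ^ 2 - 1) ≤ Valued.v (ϖ ^ (2 * (m - N))) := by rw [hc₁v, vle]; omega
      by_cases hpar : (M - N) % 2 = 0
      · have hcnt := hce hge (by omega) (by omega) hpar (fun p hp u x w hpm => by
          obtain ⟨hvu, hvx, hσx, hvw, -⟩ := borel_coords_of_mem_flickerPH σ hJ hd hc hp hpm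
          have hu0 : u ≠ 0 := fun h => by rw [h, map_zero] at hvu; exact zero_ne_one hvu
          have hσu0 : σ u ≠ 0 := fun h => hu0 (by rw [← hd.σσ u, h, map_zero])
          have hw0 : w ≠ 0 := fun h => by rw [h, map_zero] at hvw; exact zero_ne_one hvw
          have hpH : p ∈ Subgroup.centralizer ({c} : Set ↥(unitaryGroupOfForm σ J)) := ((mem_flickerPH_iff h2 hc).1 hp).1.1
          have hn : Valued.v (u * σ u) = 1 := by rw [map_mul, hd.vσ, hvu, mul_one]
          have hσn : σ (u * σ u) = u * σ u := by rw [map_mul, hd.σσ, mul_comm]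
          rw [borel_conj_mem_flickerHK_iff σ hJ hd hy m hu0 hσu0 hw0 hum hpm hτ hpH hτH,
            and_iff_right (show Valued.v ((u * σ u) * B) ≤ 1 by rw [map_mul, hn, one_mul, hB]; exact hd.v_pow_le_one N)]
          exact conditions_iff_norm_sub_le_of_near σ hd (A := A) (b := b) hB (by omega) hn hσn hσx hfg hσf (hf1 hge) hg2 hnear hfar')
        rw [hcnt, natCast_count_c_eq hq1 (k := 2 * m + N) (by omega), iThirteen, if_neg hm0, if_neg (by omega), if_neg (by omega),
          if_neg (by omega), if_neg (by omega), if_pos ⟨hge, by omega, by omega, hpar⟩]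
      · -- odd: no solution
        have hodd : ¬ ∃ e : ℤ, Valued.v (f ^ 2 - 1) = WithZero.exp (2 * e) := by
          rintro ⟨e, he⟩
          rw [hc₁v, hd.v_pow, WithZero.exp_inj] at he
          omega
        rw [natCard_cosets_jzero_eq_zero_of_odd σ hJ hd hy (by omega) hc hum hτ hτH hB hfg hσf (hf1 hge) hg2 hnear hfar' hodd,
          iThirteen, if_neg hm0, if_neg (by omega), if_neg (by omega), if_neg (by omega), if_neg (by omega),
          if_neg (by rintro ⟨-, -, -, h⟩; exact hpar h), Nat.cast_zero]

/-- **PROP. 13, `N < m` — ED. 2 (`N = 0` admitted)**: as `natCard_cosets_jzero_eq_iThirteen_of_lt`, the type-B datum WEAKENED to `|f² − 1| ≤ |ϖ^{M−N}|`, with `=` only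
for `1 ≤ N` (used solely when `M < 2m ≤ M + N`, empty at `N = 0`, where `|g| = |c₀| = |ϖ^M|` lets `|f²−1|` drop below `|ϖ^M|`). [cite: Flicker1998UnitaryFL, Prop. 13 (d)(e) pp. 91–92] -/
theorem natCard_cosets_jzero_eq_iThirteen_of_lt' (hJ : J = (StdForm.antidiagonal 3).over K) (hd : LocalConjDatum σ ϖ)
    (hσO : ∀ y : 𝒪[K], (σ.comp 𝒪[K].subtype) y ∈ 𝒪[K]) {y : K} (hy : y * σ y = -2)
    {m N Np M : ℕ} (hNm : N < m)
    {c um τ : ↥(unitaryGroupOfForm σ J)} (hc : ((c : GL (Fin 3) K) : Matrix (Fin 3) (Fin 3) K) = !![1, 0, 0; 0, -1, 0; 0, 0, 1])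
    (hum : ((um : GL (Fin 3) K) : Matrix (Fin 3) (Fin 3) K) = !![ϖ ^ m, y, (ϖ ^ m)⁻¹; 0, 1, -σ y * (ϖ ^ m)⁻¹; 0, 0, (ϖ ^ m)⁻¹])
    {A B b f g : K} (hτ : ((τ : GL (Fin 3) K) : Matrix (Fin 3) (Fin 3) K) = !![A, 0, B; 0, b, 0; B, 0, A])
    (hτH : τ ∈ Subgroup.centralizer ({c} : Set ↥(unitaryGroupOfForm σ J)))
    (hB : Valued.v B = Valued.v (ϖ ^ N)) (hs : Np < N → Valued.v (A - b) = Valued.v (ϖ ^ Np))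
    (hfg : (A - b) / B = f + g) (hσf : σ f = f) (hσg : σ g = -g) (hf1 : N ≤ Np → Valued.v f ≤ 1)
    (hreg : Np < N ∨ (N ≤ Np ∧ N ≤ M ∧ Valued.v (f ^ 2 - 1) ≤ Valued.v (ϖ ^ (M - N)) ∧
      (1 ≤ N → Valued.v (f ^ 2 - 1) = Valued.v (ϖ ^ (M - N))) ∧ Valued.v g = Valued.v (ϖ ^ M)))
    {q : ℕ} (hq : Nat.card (ResidueField 𝒪[K]) = q ^ 2)
    {a₀ : 𝒪[K]} (ha₀ : IsUnit (((σ.comp 𝒪[K].subtype).codRestrict 𝒪[K] hσO) a₀ - a₀))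
    (hSN : flickerPH σ J c ⊓ flickerHK σ J c um ≤ flickerPH0 σ J c (ϖ ^ m))
    [Finite (↥(flickerPH σ J c) ⧸ (flickerHK σ J c um).subgroupOf (flickerPH σ J c))]
    (hfib : ∀ z ∈ Set.range (fun w : ↥(flickerPH σ J c) ⧸ (flickerHK σ J c um).subgroupOf (flickerPH σ J c) =>
        flickerPHRho σ m ((Quotient.out w : ↥(flickerPH σ J c)) : ↥(unitaryGroupOfForm σ J))),
      Nat.card {w : ↥(flickerPH σ J c) ⧸ (flickerHK σ J c um).subgroupOf (flickerPH σ J c) //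
        flickerPHRho σ m ((Quotient.out w : ↥(flickerPH σ J c)) : ↥(unitaryGroupOfForm σ J)) = z} = q ^ m)
    (hce : N ≤ Np → M < 2 * m → 2 * m ≤ M + N → (M - N) % 2 = 0 →
      (∀ p ∈ flickerPH σ J c, ∀ u x w : K,
        ((p : GL (Fin 3) K) : Matrix (Fin 3) (Fin 3) K) = !![u, 0, u * x; 0, w, 0; 0, 0, (σ u)⁻¹] →
          (p⁻¹ * τ * p ∈ flickerHK σ J c um ↔
            Valued.v (((u * σ u)⁻¹ + f + x) * σ ((u * σ u)⁻¹ + f + x) - (f ^ 2 - 1)) ≤ Valued.v (ϖ ^ (2 * m - N)))) →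
      Nat.card {w : ↥(flickerPH σ J c) ⧸ (flickerHK σ J c um).subgroupOf (flickerPH σ J c) //
        ((Quotient.out w : ↥(flickerPH σ J c)) : ↥(unitaryGroupOfForm σ J))⁻¹ * τ * (Quotient.out w : ↥(flickerPH σ J c)) ∈ flickerHK σ J c um} =
        (q + 1) ^ 2 * q ^ (2 * m + N - 2)) :
    (Nat.card {w : ↥(flickerPH σ J c) ⧸ (flickerHK σ J c um).subgroupOf (flickerPH σ J c) //
      ((Quotient.out w : ↥(flickerPH σ J c)) : ↥(unitaryGroupOfForm σ J))⁻¹ * τ * (Quotient.out w : ↥(flickerPH σ J c)) ∈ flickerHK σ J c um} : ℚ) =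
      iThirteen q N Np M m := by
  have hq0 : q ≠ 0 := by rintro rfl; have h1 : 0 < Nat.card (ResidueField 𝒪[K]) := Nat.card_pos; rw [hq] at h1; simp at h1
  have hq1 : 1 ≤ q := Nat.pos_of_ne_zero hq0
  have h2 : (2 : K) ≠ 0 := fun h => by have := hd.v2; rw [h, map_zero] at this; exact zero_ne_one this
  have hB0 : B ≠ 0 := fun h => by rw [h, map_zero] at hB; exact (pow_ne_zero N hd.ϖ_ne_zero) ((Valuation.zero_iff _).1 hB.symm)
  have hvmm : Valued.v (ϖ ^ m) * Valued.v (ϖ ^ m) = Valued.v (ϖ ^ (2 * m)) := by rw [← map_mul, ← pow_add, two_mul]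
  have vle : ∀ {a b : ℕ}, Valued.v (ϖ ^ a) ≤ Valued.v (ϖ ^ b) ↔ b ≤ a := fun {a b} => by rw [hd.v_pow, hd.v_pow, WithZero.exp_le_exp]; omega
  have vlt : ∀ {a b : ℕ}, Valued.v (ϖ ^ a) < Valued.v (ϖ ^ b) ↔ b < a := fun {a b} => by rw [hd.v_pow, hd.v_pow, WithZero.exp_lt_exp]; omega
  obtain ⟨hm, hm0⟩ : 1 ≤ m ∧ m ≠ 0 := ⟨by omega, by omega⟩
  rcases hreg with hlt | ⟨hge, hNM, hc₁le, hc₁eq, hgv⟩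
  · -- N₊ < N < m : (R-kill)
    rw [natCard_cosets_jzero_eq_zero_of_v_lt σ hJ hd hy m hc hum hτ hτH (by rw [hB, hs hlt, vlt]; exact hlt) (by rw [hvmm, hs hlt, vlt]; omega),
      iThirteen, if_neg hm0, if_neg (by omega), if_neg (by omega), if_neg (by omega), if_neg (by omega), if_neg (by omega), Nat.cast_zero]
  · -- N = N₊ < m
    by_cases hfar2 : M + N < 2 * m
    · -- (R-far)
      rw [natCard_cosets_jzero_eq_zero_of_far σ hJ hd hy m hc hum hτ hτH hB0 hfg hσf hσg (by rw [hvmm, hB, hgv, ← map_mul, ← pow_add, vlt]; omega),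
        iThirteen, if_neg hm0, if_neg (by omega), if_neg (by omega), if_neg (by omega), if_neg (by omega), if_neg (by omega), Nat.cast_zero]
    have hg2 : Valued.v g ≤ Valued.v (ϖ ^ (2 * m - N)) := by rw [hgv, vle]; omega
    by_cases hbd : 2 * m ≤ M
    · -- (R-bd) : case (d)
      have hcnt := natCard_cosets_jzero_bd σ hJ hd hσO hy hm (by omega) hc hum hτ hτH hB hfg hσf (hf1 hge)
        (le_trans hc₁le (by rw [vle]; omega)) hg2 hq ha₀ hSN hfib
      rw [hcnt, cast_count_bd_eq hq1 hm (by omega), iThirteen, if_neg hm0, if_neg (by omega), if_neg (by omega), if_neg (by omega),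
        if_pos ⟨hge, by omega, by omega⟩]
    · -- (R-ce) : case (e), `M < 2m ≤ M + N`
      have hc₁v := hc₁eq (by omega)
      have hnear : Valued.v (ϖ ^ (2 * m - N)) < Valued.v (f ^ 2 - 1) := by rw [hc₁v, vlt]; omega
      have hfar' : Valued.v (f ^ 2 - 1) ≤ Valued.v (ϖ ^ (2 * (m - N))) := by rw [hc₁v, vle]; omega
      by_cases hpar : (M - N) % 2 = 0
      · have hcnt := hce hge (by omega) (by omega) hpar (fun p hp u x w hpm => by
          obtain ⟨hvu, hvx, hσx, hvw, -⟩ := borel_coords_of_mem_flickerPH σ hJ hd hc hp hpm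
          have hu0 : u ≠ 0 := fun h => by rw [h, map_zero] at hvu; exact zero_ne_one hvu
          have hσu0 : σ u ≠ 0 := fun h => hu0 (by rw [← hd.σσ u, h, map_zero])
          have hw0 : w ≠ 0 := fun h => by rw [h, map_zero] at hvw; exact zero_ne_one hvw
          have hpH : p ∈ Subgroup.centralizer ({c} : Set ↥(unitaryGroupOfForm σ J)) := ((mem_flickerPH_iff h2 hc).1 hp).1.1
          have hn : Valued.v (u * σ u) = 1 := by rw [map_mul, hd.vσ, hvu, mul_one]
          have hσn : σ (u * σ u) = u * σ u := by rw [map_mul, hd.σσ, mul_comm]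
          rw [borel_conj_mem_flickerHK_iff σ hJ hd hy m hu0 hσu0 hw0 hum hpm hτ hpH hτH,
            and_iff_right (show Valued.v ((u * σ u) * B) ≤ 1 by rw [map_mul, hn, one_mul, hB]; exact hd.v_pow_le_one N)]
          exact conditions_iff_norm_sub_le_of_near σ hd (A := A) (b := b) hB (by omega) hn hσn hσx hfg hσf (hf1 hge) hg2 hnear hfar')
        rw [hcnt, natCast_count_c_eq hq1 (k := 2 * m + N) (by omega), iThirteen, if_neg hm0, if_neg (by omega), if_neg (by omega),
          if_neg (by omega), if_neg (by omega), if_pos ⟨hge, by omega, by omega, hpar⟩]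
      · -- odd: no solution
        have hodd : ¬ ∃ e : ℤ, Valued.v (f ^ 2 - 1) = WithZero.exp (2 * e) := by
          rintro ⟨e, he⟩; rw [hc₁v, hd.v_pow, WithZero.exp_inj] at he; omega
        rw [natCard_cosets_jzero_eq_zero_of_odd σ hJ hd hy (by omega) hc hum hτ hτH hB hfg hσf (hf1 hge) hg2 hnear hfar' hodd,
          iThirteen, if_neg hm0, if_neg (by omega), if_neg (by omega), if_neg (by omega), if_neg (by omega),
          if_neg (by rintro ⟨-, -, -, h⟩; exact hpar h), Nat.cast_zero]

end Count

end UnitaryGroup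

end Literature.NumberTheory.Automorphic
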